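import Summits.QuantumFields.BalabanUV.T4Continuum.Support.NE7QbarMassLetter
import Summits.QuantumFields.BalabanUV.T4Continuum.Support.NE7DirIterL1Letter
import Summits.QuantumFields.BalabanUV.T4Continuum.Support.NE3CurlOfGaugeDir
import HarnessLib

/-!
# NE7QbarEnergyLetter — THE COARSE MAXWELL ENERGY OF THE STRAIGHT PART OF ONE LINEARISED AVERAGING STEP, ROOT FORM:
# `√(Σ_P ‖curl_{V̄}(Q̄_W Y)(P)‖²_{HS∕n}) ≤ √(L⁴∕L^d)·√(Σ_p ‖curl_W Y(p)‖²_{HS∕n}) + √energyErrC(d,L)·qbarCurlC(d,L)·a·√‖Y‖²_{ℓ²}`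
# (lineage `b2b-balaban-t4-ne7-p1`, gen 117, file F3c; ROAD-G116 §7∕§9 (G1), the energy letter for the FRAME-CORRECTED tower)

Cell `pub-balaban`, rung (B)+1 sub-cell t4, CRUX PROVER NE7 #1 (OWNER of row NE7), generation 117.  The one-step split `cpush = Q̄ + gaugeDir (cavg W) F̄`
(✓ `cpush_eq_Qbar_add_gaugeDir`) and the EXACT dressed curl of a gauge direction (✓ `NE3CurlOfGaugeDir.curlAt_gaugeDir`: `curl_{V̄}(gaugeDir_{V̄} F̄)(z) = F̄(z) − Ad_{V̄(∂P)} F̄(z)`,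
of size `≤ 2ā‖F̄(z)‖`, `ā = prop1Radius ≤ cRad·a` the coarse plaquette radius) turn F2's letter for `cpush` (✓ `norm_curlAt_cavg_cpush_sub_avgAd_le`) into the same letter for the STRAIGHT part:
`curl_{V̄}(Q̄_W Y)(z;μ,ν) = Σ_r L^{−d}•Σ_{i,j<L} Ad_{W(Γ_{Lz,p})} curl_W Y(p;μ,ν) + E′`, `‖E′‖ ≤ qbarCurlC(d,L)·a·dirL1 Y (box ((2d+4)L) (L•z))` (the frame reads only the `nbRad`-box, ✓
`NE7DirIterL1Letter.norm_Fbar_le_box`).  On the torus: Jensen (✓ `nhsNormSq_blockAvg_le`, ✓ `nhsNormSq_Ad`), the covering identity (✓ `sum_stencil_periodBox`), Cauchy–Schwarz and the box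
multiplicity (✓ F3), and Minkowski (✓ F3b `sqrt_sum_nhsNormSq_add_le`) — ROOT FORM, no multiplicative loss on the main term.
WHAT ([folklore]; 0 sorry): `norm_curlAt_cavg_Qbar_sub_avgAd_le` (pointwise), `sum_nhsNormSq_avgAd_le` (main term on the torus, `L⁴∕L^d`), `sum_normSq_curl_Qbar_rem_le` and
`sum_normSq_curl_cpush_rem_le` (remainders), **`sqrt_curl_energy_Qbar_le`** and **`sqrt_curl_energy_cpush_le`** (root forms for `Q̄` and for the full linearised average).
HONEST FRAMING: lattice kinematics of ONE averaging step; constants polynomial in `d, L`, not optimised; nothing of Bałaban's asserted ((48), (120) context only); NOT (G′), NOT NE7 as a spine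
node, NOT NE3; spine 0∕9; finite T⁴ rung (B)+1 — NOT infinite volume, NOT mass gap, NOT BetaPertH, NOT Clay.
-/

set_option autoImplicit false

open scoped BigOperators Matrix.Norms.L2Operator
open NormedSpace Finset

namespace Summit.QuantumFields.BalabanUV.T4Continuum.NE7QbarEnergyLetter

open Literature.MathematicalPhysics.QuantumFieldTheory.Balaban1983to89
open B7Prop1Explicit B7Prop2Explicit MatrixLog UnitaryModel
open T4AveragingDeficitWall (IsUnitaryCfg SmallField Ad curl curlAt dirL1 dirSq box)
open T4AveragingDeficitWallBoundary (IsPeriodicCfg periodBox blockSites_periodBox)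
open T4AveragingDeficitNonAbelian (sum_stencil_periodBox)
open AveragingDeficitPeriodicCounting (IsPeriodicDir curl_add_period sum_periodBox_box_le)
open AveragingDeficitCounting (card_box_eq box_mono)
open AveragingDeficitDerivCore (dirL1_nonneg)
open AveragingDeficitTransport (norm_Ad_of_unitary mem_U1_of_unitary)
open AveragingDeficitNearIdentity (norm_Ad_sub_le)
open AveragingDeficitChartCalculus (cavg)
open AveragingDeficitMultiLevelPrep (cpush)
open AveragingDeficitTwoLevelPrep (prop1Radius smallField_cavg cavg_isUnitaryCfg)
open AveragingDeficitHSInner (nhsNormSq_Ad)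
open MatrixNorms (nhsNormSq nhsNormSq_nonneg nhsNormSq_le_opNorm_sq)
open MinimalActionLevels (perWin)
open BlockAverageVaryHolo (nbRad)
open BlockAveragePushDirGauge (gaugeDir)
open NE3TangentCovariantStructure (Qbar Fbar cpush_eq_Qbar_add_gaugeDir)
open NE3CurlOfGaugeDir (curlAt_gaugeDir curlAt_sub)
open NE3EnergyHessContTwoTerm (dirSq_nonneg)
open NE7CoarseCurlEnergyFlatSharp (nhsNormSq_blockAvg_le)
open NE7CurvedAverageCurlLetter (curlLetterC curlLetterC_nonneg norm_curlAt_cavg_cpush_sub_avgAd_le dirL1_mono)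
open NE7CoarseCurlEnergyCurved (energyErrC energyErrC_nonneg dirL1_sq_le_card_mul_dirSq)
open NE7QbarMassLetter (sqrt_sum_nhsNormSq_add_le)
open NE7DirIterL1Letter (norm_Fbar_le_box)

noncomputable section

variable {d : ℕ} {n : Type*} [Fintype n] [DecidableEq n]

/-- THE MAIN TERM of Bałaban's (48) at a curved background: the block average of the transported fine curls,
`avgAd L W Y z μ ν = Σ_r L^{−d} • Σ_{i,j<L} Ad_{W(Γ_{Lz,p})} (curlAt W Y p μ ν)`, `p = L•z + x_r + i e_μ + j e_ν`. [cite: Balaban1985Averaging, (48) p.25] -/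
def avgAd (L : ℕ) (W : Site d → Fin d → (Matrix n n ℂ)ˣ) (Y : Site d → Fin d → Matrix n n ℂ) (z : Site d) (μ ν : Fin d) : Matrix n n ℂ :=
  ∑ r : Fin d → Fin L, (((L : ℝ) ^ d)⁻¹ : ℝ) • ∑ i ∈ Finset.range L, ∑ j ∈ Finset.range L,
    Ad (hol W ((L : ℤ) • z) (treeWord (boxVec L r + (i : ℤ) • e μ + (j : ℤ) • e ν)))
      (curlAt W Y ((L : ℤ) • z + boxVec L r + (i : ℤ) • e μ + (j : ℤ) • e ν) μ ν)

/-! ## §1 Pointwise: the straight part -/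

omit [Fintype n] [DecidableEq n] in
/-- The coarse plaquette radius of B7 Prop. 1 is LINEAR in the fine one in the standard class: `prop1Radius d L a ≤ (1 + 29(d+1)(d+4))L²·a` when `512(d+1)(d+4)L²a ≤ 1`
(cf. `AveragingDeficitDualResidualCD.prop1Radius_le_cRad_mul`, same constant). [cite: Balaban1985Averaging, Prop. 1 p.24] -/
theorem prop1Radius_le_linear {L : ℕ} {a : ℝ} (ha : 0 ≤ a) (h512 : 512 * (d + 1) * (d + 4) * (L : ℝ) ^ 2 * a ≤ 1) :
    prop1Radius d L a ≤ (1 + 29 * ((d : ℝ) + 1) * ((d : ℝ) + 4)) * (L : ℝ) ^ 2 * a := by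
  unfold prop1Radius
  set x : ℝ := 8 * ((d : ℝ) + 1) * ((d : ℝ) + 4) * (L : ℝ) ^ 2 * a with hx
  have hx0 : 0 ≤ x := by rw [hx]; positivity
  have hx64 : 64 * x ≤ 1 := by rw [hx]; nlinarith
  have h1 : 226 * x ^ 2 ≤ (226 / 64) * x := by nlinarith
  have h2 : (226 / 64 : ℝ) * x ≤ 29 * ((d : ℝ) + 1) * ((d : ℝ) + 4) * (L : ℝ) ^ 2 * a := by
    rw [hx]; have : 0 ≤ ((d : ℝ) + 1) * ((d : ℝ) + 4) * (L : ℝ) ^ 2 * a := by positivity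
    nlinarith
  nlinarith

/-- THE REMAINDER CONSTANT for the straight part: `qbarCurlC d L = curlLetterC d L + 2·(1 + 29(d+1)(d+4))L²·(d·L)`. [folklore] -/
def qbarCurlC (d L : ℕ) : ℝ := curlLetterC d L + 2 * ((1 + 29 * ((d : ℝ) + 1) * ((d : ℝ) + 4)) * (L : ℝ) ^ 2) * ((d : ℝ) * L)

omit [Fintype n] [DecidableEq n] in
/-- `0 ≤ qbarCurlC d L`. [folklore] -/
theorem qbarCurlC_nonneg (d L : ℕ) : 0 ≤ qbarCurlC d L := by
  unfold qbarCurlC; have := curlLetterC_nonneg d L; positivity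

/-- **POINTWISE, STRAIGHT PART**: for `U(N)` data `W` in the standard small-field class, every `Y`, every coarse plaquette `(z; μ, ν)`,
`‖curlAt (cavg L W) (Qbar L W Y) z μ ν − avgAd L W Y z μ ν‖ ≤ qbarCurlC d L · a · dirL1 Y (box ((2d+4)L) (L•z))` — F2's letter for `cpush` minus the EXACT dressed curl of the frame
gauge direction (`≤ 2·prop1Radius·‖F̄(z)‖`, the frame reading only the `nbRad`-box). [cite: Balaban1985Averaging, (48) p.25, (120) p.35] -/
theorem norm_curlAt_cavg_Qbar_sub_avgAd_le [Nonempty n] {L : ℕ} (hL : 1 ≤ L) {W : Site d → Fin d → (Matrix n n ℂ)ˣ} (hW : IsUnitaryCfg W)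
    {a : ℝ} (ha : 0 ≤ a) (h512 : 512 * (d + 1) * (d + 4) * (L : ℝ) ^ 2 * a ≤ 1) (hWa : SmallField W a)
    (Y : Site d → Fin d → Matrix n n ℂ) (z : Site d) (μ ν : Fin d) :
    ‖curlAt (cavg L W) (Qbar L W Y) z μ ν - avgAd L W Y z μ ν‖ ≤ qbarCurlC d L * a * dirL1 Y (box ((2 * d + 4) * L) ((L : ℤ) • z)) := by
  set D : ℝ := dirL1 Y (box ((2 * d + 4) * L) ((L : ℤ) • z)) with hD
  have hD0 : 0 ≤ D := dirL1_nonneg Y _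
  -- the straight part is the full linearised average minus the frame gauge direction
  have hQ : Qbar L W Y = fun x κ => cpush L W Y x κ - gaugeDir (cavg L W) (Fbar L W Y) x κ := by
    funext x κ; rw [cpush_eq_Qbar_add_gaugeDir, add_sub_cancel_right]
  rw [hQ, curlAt_sub]
  have h1 := norm_curlAt_cavg_cpush_sub_avgAd_le hL hW ha h512 hWa Y z μ ν
  -- the gauge part, exactly
  have hVu : IsUnitaryCfg (cavg L W) := cavg_isUnitaryCfg hL hW ha h512 hWa
  have hVa : SmallField (cavg L W) (prop1Radius d L a) := smallField_cavg hL hW ha h512 hWa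
  have hbar : prop1Radius d L a ≤ (1 + 29 * ((d : ℝ) + 1) * ((d : ℝ) + 4)) * (L : ℝ) ^ 2 * a := prop1Radius_le_linear ha h512
  have hC0 : 0 ≤ (1 + 29 * ((d : ℝ) + 1) * ((d : ℝ) + 4)) * (L : ℝ) ^ 2 := by positivity
  have hF : ‖Fbar L W Y z‖ ≤ ((d : ℝ) * L) * D := by
    refine (norm_Fbar_le_box hL hW Y z).trans (mul_le_mul_of_nonneg_left (dirL1_mono Y (box_mono ?_ _)) (by positivity))
    unfold BlockAverageVaryHolo.nbRad; nlinarith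
  have h2 : ‖curlAt (cavg L W) (gaugeDir (cavg L W) (Fbar L W Y)) z μ ν‖ ≤ 2 * ((1 + 29 * ((d : ℝ) + 1) * ((d : ℝ) + 4)) * (L : ℝ) ^ 2 * a) * (((d : ℝ) * L) * D) := by
    rw [curlAt_gaugeDir, ← norm_neg, neg_sub]
    refine (norm_Ad_sub_le (hol_mem_of hVu _ _) _).trans ?_
    have hplaq : ‖((hol (cavg L W) z (plaqWord μ ν) : (Matrix n n ℂ)ˣ) : Matrix n n ℂ) - 1‖ ≤ (1 + 29 * ((d : ℝ) + 1) * ((d : ℝ) + 4)) * (L : ℝ) ^ 2 * a := by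
      by_cases hμν : μ = ν
      · subst hμν
        have : hol (cavg L W) z (plaqWord μ μ) = 1 := by
          rw [AveragingDeficitCovGrad.hol_plaqWord_units]; group
        rw [this, Units.val_one, sub_self, norm_zero]; exact mul_nonneg hC0 ha
      · exact (hVa z μ ν hμν).trans hbar
    have hF0 : 0 ≤ ‖Fbar L W Y z‖ := norm_nonneg _
    calc 2 * ‖((hol (cavg L W) z (plaqWord μ ν) : (Matrix n n ℂ)ˣ) : Matrix n n ℂ) - 1‖ * ‖Fbar L W Y z‖
        ≤ 2 * ((1 + 29 * ((d : ℝ) + 1) * ((d : ℝ) + 4)) * (L : ℝ) ^ 2 * a) * ‖Fbar L W Y z‖ := by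
          nlinarith [norm_nonneg (((hol (cavg L W) z (plaqWord μ ν) : (Matrix n n ℂ)ˣ) : Matrix n n ℂ) - 1)]
      _ ≤ 2 * ((1 + 29 * ((d : ℝ) + 1) * ((d : ℝ) + 4)) * (L : ℝ) ^ 2 * a) * (((d : ℝ) * L) * D) := mul_le_mul_of_nonneg_left hF (by positivity)
  have e1 : curlAt (cavg L W) (cpush L W Y) z μ ν - curlAt (cavg L W) (gaugeDir (cavg L W) (Fbar L W Y)) z μ ν - avgAd L W Y z μ ν
      = (curlAt (cavg L W) (cpush L W Y) z μ ν - avgAd L W Y z μ ν) - curlAt (cavg L W) (gaugeDir (cavg L W) (Fbar L W Y)) z μ ν := by abel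
  rw [e1]
  refine (norm_sub_le _ _).trans ?_
  unfold avgAd at *
  calc _ ≤ curlLetterC d L * a * D + 2 * ((1 + 29 * ((d : ℝ) + 1) * ((d : ℝ) + 4)) * (L : ℝ) ^ 2 * a) * (((d : ℝ) * L) * D) := add_le_add h1 h2
    _ = qbarCurlC d L * a * D := by unfold qbarCurlC; ring

/-! ## §2 On the torus: the main term, the remainders, the root forms -/

/-- **THE MAIN TERM ON THE TORUS**: `Σ_{z∈periodBox M} Σ_π nhsNormSq (avgAd L W Y z π) ≤ (L⁴∕L^d)·Σ_{p∈perWin (L·M)} nhsNormSq (curl W Y p)` for `W` unitary and `Y` such that the fine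
curl is `L·M`-periodic (Jensen; the transports are HS isometries; every fine plaquette counted `L²` times). [cite: Balaban1985Averaging, (48) p.25] -/
theorem sum_nhsNormSq_avgAd_le [Nonempty n] {L M : ℕ} [NeZero L] (hL : 1 ≤ L) (hM : 1 ≤ M) {W : Site d → Fin d → (Matrix n n ℂ)ˣ}
    (hW : IsUnitaryCfg W) (hWP : IsPeriodicCfg W ((L : ℤ) * M)) {Y : Site d → Fin d → Matrix n n ℂ} (hYP : IsPeriodicDir Y ((L : ℤ) * M)) :
    ∑ z ∈ periodBox M, ∑ π : T4AveragingDeficitWall.Plane d, nhsNormSq (avgAd L W Y z π.1.1 π.1.2)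
      ≤ (L : ℝ) ^ 4 / (L : ℝ) ^ d * ∑ p ∈ perWin d (L * M), nhsNormSq (curl W Y p) := by
  classical
  have hL0 : (L : ℝ) ≠ 0 := by exact_mod_cast (NeZero.ne L)
  have hLM : (((L * M : ℕ) : ℤ)) = (L : ℤ) * M := by push_cast; ring
  have hcurlP : ∀ (π : T4AveragingDeficitWall.Plane d) (x : Site d) (κ : Fin d),
      nhsNormSq (curl W Y (x + ((L * M : ℕ) : ℤ) • e κ, π)) = nhsNormSq (curl W Y (x, π)) := by
    intro π x κ; rw [hLM, curl_add_period hWP hYP x κ π]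
  have hpt : ∀ (z : Site d) (π : T4AveragingDeficitWall.Plane d), nhsNormSq (avgAd L W Y z π.1.1 π.1.2)
      ≤ (L : ℝ) ^ 2 / (L : ℝ) ^ d * ∑ r : Fin d → Fin L, ∑ i ∈ Finset.range L, ∑ j ∈ Finset.range L,
          nhsNormSq (curl W Y ((L : ℤ) • z + boxVec L r + (i : ℤ) • e π.1.1 + (j : ℤ) • e π.1.2, π)) := by
    intro z π
    unfold avgAd
    refine (nhsNormSq_blockAvg_le L _).trans (le_of_eq ?_)
    congr 1
    refine Finset.sum_congr rfl fun r _ => Finset.sum_congr rfl fun i _ => Finset.sum_congr rfl fun j _ => ?_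
    exact nhsNormSq_Ad (hol_mem_of hW _ _) _
  rw [perWin, Finset.sum_product]
  calc ∑ z ∈ periodBox M, ∑ π : T4AveragingDeficitWall.Plane d, nhsNormSq (avgAd L W Y z π.1.1 π.1.2)
      ≤ ∑ z ∈ periodBox M, ∑ π : T4AveragingDeficitWall.Plane d, ((L : ℝ) ^ 2 / (L : ℝ) ^ d * ∑ r : Fin d → Fin L, ∑ i ∈ Finset.range L, ∑ j ∈ Finset.range L,
          nhsNormSq (curl W Y ((L : ℤ) • z + boxVec L r + (i : ℤ) • e π.1.1 + (j : ℤ) • e π.1.2, π))) :=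
        Finset.sum_le_sum fun z _ => Finset.sum_le_sum fun π _ => hpt z π
    _ = (L : ℝ) ^ 2 / (L : ℝ) ^ d * ∑ π : T4AveragingDeficitWall.Plane d, ∑ z ∈ periodBox M,
          ∑ r : Fin d → Fin L, ∑ i ∈ Finset.range L, ∑ j ∈ Finset.range L,
            nhsNormSq (curl W Y ((L : ℤ) • z + boxVec L r + (i : ℤ) • e π.1.1 + (j : ℤ) • e π.1.2, π)) := by
        rw [Finset.sum_comm, Finset.mul_sum]
        exact Finset.sum_congr rfl fun π _ => by rw [Finset.mul_sum]
    _ = (L : ℝ) ^ 2 / (L : ℝ) ^ d * ∑ π : T4AveragingDeficitWall.Plane d, ((L : ℝ) ^ 2 * ∑ x ∈ periodBox (L * M), nhsNormSq (curl W Y (x, π))) := by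
        congr 1
        refine Finset.sum_congr rfl fun π _ => ?_
        rw [sum_stencil_periodBox L M hL hM (g := fun x => nhsNormSq (curl W Y (x, π))) (fun x κ => hcurlP π x κ) π.1.1 π.1.2, blockSites_periodBox L M hL]
    _ = (L : ℝ) ^ 4 / (L : ℝ) ^ d * ∑ x ∈ periodBox (L * M), ∑ π : T4AveragingDeficitWall.Plane d, nhsNormSq (curl W Y (x, π)) := by
        rw [← Finset.mul_sum, Finset.sum_comm, ← mul_assoc]
        congr 1
        ring

/-- The remainder summed over the torus from a pointwise box-`ℓ¹` bound with constant `K`: `Σ_z Σ_π ‖R z π‖² ≤ energyErrC d L·K²·dirSq Y (periodBox (L·M))`. [folklore] -/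
theorem sum_normSq_rem_le {L M : ℕ} [NeZero L] (hL : 1 ≤ L) (hM : 1 ≤ M) {Y : Site d → Fin d → Matrix n n ℂ} (hYP : IsPeriodicDir Y ((L : ℤ) * M))
    (R : Site d → T4AveragingDeficitWall.Plane d → Matrix n n ℂ) {K : ℝ}
    (hR : ∀ (z : Site d) (π : T4AveragingDeficitWall.Plane d), ‖R z π‖ ≤ K * dirL1 Y (box ((2 * d + 4) * L) ((L : ℤ) • z))) :
    ∑ z ∈ periodBox M, ∑ π : T4AveragingDeficitWall.Plane d, ‖R z π‖ ^ 2 ≤ energyErrC d L * K ^ 2 * dirSq Y (periodBox (L * M)) := by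
  classical
  set Rr : ℕ := (2 * d + 4) * L with hRr
  have hLM : (((L * M : ℕ) : ℤ)) = (L : ℤ) * M := by push_cast; ring
  have hmassP : ∀ (x : Site d) (ι : Fin d), (∑ μ : Fin d, ‖Y (x + ((L * M : ℕ) : ℤ) • e ι) μ‖ ^ 2) = ∑ μ : Fin d, ‖Y x μ‖ ^ 2 := by
    intro x ι; rw [hLM]; exact Finset.sum_congr rfl fun μ _ => by rw [hYP x ι μ]
  have hpt : ∀ (z : Site d) (π : T4AveragingDeficitWall.Plane d),
      ‖R z π‖ ^ 2 ≤ K ^ 2 * ((((2 * Rr + 1) ^ d * d : ℕ) : ℝ) * dirSq Y (box Rr ((L : ℤ) • z))) := by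
    intro z π
    have h0 : 0 ≤ ‖R z π‖ := norm_nonneg _
    refine (pow_le_pow_left₀ h0 (hR z π) 2).trans ?_
    rw [mul_pow]
    refine mul_le_mul_of_nonneg_left ?_ (sq_nonneg K)
    have hcs := dirL1_sq_le_card_mul_dirSq Y (box Rr ((L : ℤ) • z))
    rwa [card_box_eq] at hcs
  have herr : ∑ z ∈ periodBox M, dirSq Y (box Rr ((L : ℤ) • z)) ≤ (((2 * Rr + 1) ^ d : ℕ) : ℝ) * dirSq Y (periodBox (L * M)) := by
    have h := sum_periodBox_box_le L M hL hM Rr (g := fun x => ∑ μ : Fin d, ‖Y x μ‖ ^ 2) (fun x => Finset.sum_nonneg fun _ _ => sq_nonneg _) hmassP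
    unfold T4AveragingDeficitWall.dirSq
    exact_mod_cast h
  calc ∑ z ∈ periodBox M, ∑ π : T4AveragingDeficitWall.Plane d, ‖R z π‖ ^ 2
      ≤ ∑ z ∈ periodBox M, ∑ _π : T4AveragingDeficitWall.Plane d, K ^ 2 * ((((2 * Rr + 1) ^ d * d : ℕ) : ℝ) * dirSq Y (box Rr ((L : ℤ) • z))) :=
        Finset.sum_le_sum fun z _ => Finset.sum_le_sum fun π _ => hpt z π
    _ = (Fintype.card (T4AveragingDeficitWall.Plane d) : ℝ) * (K ^ 2 * (((2 * Rr + 1) ^ d * d : ℕ) : ℝ)) * ∑ z ∈ periodBox M, dirSq Y (box Rr ((L : ℤ) • z)) := by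
        simp only [Finset.sum_const, Finset.card_univ, nsmul_eq_mul, ← Finset.mul_sum]; ring
    _ ≤ (Fintype.card (T4AveragingDeficitWall.Plane d) : ℝ) * (K ^ 2 * (((2 * Rr + 1) ^ d * d : ℕ) : ℝ)) * ((((2 * Rr + 1) ^ d : ℕ) : ℝ) * dirSq Y (periodBox (L * M))) :=
        mul_le_mul_of_nonneg_left herr (by positivity)
    _ = _ := by simp only [energyErrC, ← hRr]; ring

/-- **ROOT FORM, STRAIGHT PART** (`W` unitary of period `L·M` in the standard small-field class, `Y` of period `L·M`):
`√(Σ_{P∈perWin M} nhsNormSq (curl (cavg L W) (Qbar L W Y) P)) ≤ √(L⁴∕L^d)·√(Σ_{p∈perWin (L·M)} nhsNormSq (curl W Y p)) + √(energyErrC d L)·(qbarCurlC d L·a)·√(dirSq Y (periodBox (L·M)))`.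
[cite: Balaban1985Averaging, (48) p.25, (120) p.35] -/
theorem sqrt_curl_energy_Qbar_le [Nonempty n] {L M : ℕ} [NeZero L] (hL : 1 ≤ L) (hM : 1 ≤ M) {W : Site d → Fin d → (Matrix n n ℂ)ˣ}
    (hW : IsUnitaryCfg W) (hWP : IsPeriodicCfg W ((L : ℤ) * M))
    {a : ℝ} (ha : 0 ≤ a) (h512 : 512 * (d + 1) * (d + 4) * (L : ℝ) ^ 2 * a ≤ 1) (hWa : SmallField W a)
    {Y : Site d → Fin d → Matrix n n ℂ} (hYP : IsPeriodicDir Y ((L : ℤ) * M)) :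
    Real.sqrt (∑ P ∈ perWin d M, nhsNormSq (curl (cavg L W) (Qbar L W Y) P))
      ≤ Real.sqrt ((L : ℝ) ^ 4 / (L : ℝ) ^ d) * Real.sqrt (∑ p ∈ perWin d (L * M), nhsNormSq (curl W Y p))
        + Real.sqrt (energyErrC d L) * (qbarCurlC d L * a) * Real.sqrt (dirSq Y (periodBox (L * M))) := by
  classical
  have hK0 : 0 ≤ qbarCurlC d L * a := mul_nonneg (qbarCurlC_nonneg d L) ha
  set A : Site d × T4AveragingDeficitWall.Plane d → Matrix n n ℂ := fun P => avgAd L W Y P.1 P.2.1.1 P.2.1.2 with hA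
  set B : Site d × T4AveragingDeficitWall.Plane d → Matrix n n ℂ := fun P => curl (cavg L W) (Qbar L W Y) P - A P with hB
  have hsplit : ∑ P ∈ perWin d M, nhsNormSq (curl (cavg L W) (Qbar L W Y) P) = ∑ P ∈ perWin d M, nhsNormSq (A P + B P) :=
    Finset.sum_congr rfl fun P _ => by simp only [hB, add_sub_cancel]
  rw [hsplit]
  refine (sqrt_sum_nhsNormSq_add_le _ A B).trans (add_le_add ?_ ?_)
  · have h := sum_nhsNormSq_avgAd_le hL hM hW hWP hYP
    have h' : ∑ P ∈ perWin d M, nhsNormSq (A P) = ∑ z ∈ periodBox M, ∑ π : T4AveragingDeficitWall.Plane d, nhsNormSq (avgAd L W Y z π.1.1 π.1.2) := by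
      rw [perWin, Finset.sum_product]
    rw [h']
    calc Real.sqrt (∑ z ∈ periodBox M, ∑ π : T4AveragingDeficitWall.Plane d, nhsNormSq (avgAd L W Y z π.1.1 π.1.2))
        ≤ Real.sqrt ((L : ℝ) ^ 4 / (L : ℝ) ^ d * ∑ p ∈ perWin d (L * M), nhsNormSq (curl W Y p)) := Real.sqrt_le_sqrt h
      _ = _ := Real.sqrt_mul (by positivity) _
  · have hrem := sum_normSq_rem_le hL hM hYP (fun z π => curl (cavg L W) (Qbar L W Y) (z, π) - avgAd L W Y z π.1.1 π.1.2)
      (fun z π => norm_curlAt_cavg_Qbar_sub_avgAd_le hL hW ha h512 hWa Y z π.1.1 π.1.2)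
    have h1 : ∑ P ∈ perWin d M, nhsNormSq (B P)
        ≤ ∑ z ∈ periodBox M, ∑ π : T4AveragingDeficitWall.Plane d, ‖curl (cavg L W) (Qbar L W Y) (z, π) - avgAd L W Y z π.1.1 π.1.2‖ ^ 2 := by
      rw [perWin, Finset.sum_product]
      exact Finset.sum_le_sum fun z _ => Finset.sum_le_sum fun π _ => nhsNormSq_le_opNorm_sq _
    calc Real.sqrt (∑ P ∈ perWin d M, nhsNormSq (B P))
        ≤ Real.sqrt (energyErrC d L * (qbarCurlC d L * a) ^ 2 * dirSq Y (periodBox (L * M))) := Real.sqrt_le_sqrt (h1.trans hrem)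
      _ = Real.sqrt (energyErrC d L) * (qbarCurlC d L * a) * Real.sqrt (dirSq Y (periodBox (L * M))) := by
          rw [Real.sqrt_mul (mul_nonneg (energyErrC_nonneg d L) (sq_nonneg _)), Real.sqrt_mul (energyErrC_nonneg d L), Real.sqrt_sq hK0]

/-- **ROOT FORM, FULL LINEARISED AVERAGE** (the root form of F3): same hypotheses,
`√(Σ_{P∈perWin M} nhsNormSq (curl (cavg L W) (cpush L W Y) P)) ≤ √(L⁴∕L^d)·√(Σ_p nhsNormSq (curl W Y p)) + √(energyErrC d L)·(curlLetterC d L·a)·√(dirSq Y (periodBox (L·M)))`.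
[cite: Balaban1985Averaging, (48) p.25] -/
theorem sqrt_curl_energy_cpush_le [Nonempty n] {L M : ℕ} [NeZero L] (hL : 1 ≤ L) (hM : 1 ≤ M) {W : Site d → Fin d → (Matrix n n ℂ)ˣ}
    (hW : IsUnitaryCfg W) (hWP : IsPeriodicCfg W ((L : ℤ) * M))
    {a : ℝ} (ha : 0 ≤ a) (h512 : 512 * (d + 1) * (d + 4) * (L : ℝ) ^ 2 * a ≤ 1) (hWa : SmallField W a)
    {Y : Site d → Fin d → Matrix n n ℂ} (hYP : IsPeriodicDir Y ((L : ℤ) * M)) :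
    Real.sqrt (∑ P ∈ perWin d M, nhsNormSq (curl (cavg L W) (cpush L W Y) P))
      ≤ Real.sqrt ((L : ℝ) ^ 4 / (L : ℝ) ^ d) * Real.sqrt (∑ p ∈ perWin d (L * M), nhsNormSq (curl W Y p))
        + Real.sqrt (energyErrC d L) * (curlLetterC d L * a) * Real.sqrt (dirSq Y (periodBox (L * M))) := by
  classical
  have hK0 : 0 ≤ curlLetterC d L * a := mul_nonneg (curlLetterC_nonneg d L) ha
  set A : Site d × T4AveragingDeficitWall.Plane d → Matrix n n ℂ := fun P => avgAd L W Y P.1 P.2.1.1 P.2.1.2 with hA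
  set B : Site d × T4AveragingDeficitWall.Plane d → Matrix n n ℂ := fun P => curl (cavg L W) (cpush L W Y) P - A P with hB
  have hsplit : ∑ P ∈ perWin d M, nhsNormSq (curl (cavg L W) (cpush L W Y) P) = ∑ P ∈ perWin d M, nhsNormSq (A P + B P) :=
    Finset.sum_congr rfl fun P _ => by simp only [hB, add_sub_cancel]
  rw [hsplit]
  refine (sqrt_sum_nhsNormSq_add_le _ A B).trans (add_le_add ?_ ?_)
  · have h := sum_nhsNormSq_avgAd_le hL hM hW hWP hYP
    have h' : ∑ P ∈ perWin d M, nhsNormSq (A P) = ∑ z ∈ periodBox M, ∑ π : T4AveragingDeficitWall.Plane d, nhsNormSq (avgAd L W Y z π.1.1 π.1.2) := by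
      rw [perWin, Finset.sum_product]
    rw [h']
    calc Real.sqrt (∑ z ∈ periodBox M, ∑ π : T4AveragingDeficitWall.Plane d, nhsNormSq (avgAd L W Y z π.1.1 π.1.2))
        ≤ Real.sqrt ((L : ℝ) ^ 4 / (L : ℝ) ^ d * ∑ p ∈ perWin d (L * M), nhsNormSq (curl W Y p)) := Real.sqrt_le_sqrt h
      _ = _ := Real.sqrt_mul (by positivity) _
  · have hrem := sum_normSq_rem_le hL hM hYP (fun z π => curl (cavg L W) (cpush L W Y) (z, π) - avgAd L W Y z π.1.1 π.1.2)
      (fun z π => by unfold avgAd; exact norm_curlAt_cavg_cpush_sub_avgAd_le hL hW ha h512 hWa Y z π.1.1 π.1.2)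
    have h1 : ∑ P ∈ perWin d M, nhsNormSq (B P)
        ≤ ∑ z ∈ periodBox M, ∑ π : T4AveragingDeficitWall.Plane d, ‖curl (cavg L W) (cpush L W Y) (z, π) - avgAd L W Y z π.1.1 π.1.2‖ ^ 2 := by
      rw [perWin, Finset.sum_product]
      exact Finset.sum_le_sum fun z _ => Finset.sum_le_sum fun π _ => nhsNormSq_le_opNorm_sq _
    calc Real.sqrt (∑ P ∈ perWin d M, nhsNormSq (B P))
        ≤ Real.sqrt (energyErrC d L * (curlLetterC d L * a) ^ 2 * dirSq Y (periodBox (L * M))) := Real.sqrt_le_sqrt (h1.trans hrem)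
      _ = Real.sqrt (energyErrC d L) * (curlLetterC d L * a) * Real.sqrt (dirSq Y (periodBox (L * M))) := by
          rw [Real.sqrt_mul (mul_nonneg (energyErrC_nonneg d L) (sq_nonneg _)), Real.sqrt_mul (energyErrC_nonneg d L), Real.sqrt_sq hK0]

end

end Summit.QuantumFields.BalabanUV.T4Continuum.NE7QbarEnergyLetter
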